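import Literature.MathematicalPhysics.QuantumFieldTheory.Balaban1983to89.Node00.Record13Chi

/-!
# NODE 00 — K0 σ-CLOSURE χ-EDITIONS, SECOND TRANCHE, FILE F1 (dag-lead g40 WORDS 58x HANDS-3 H3.1; RR-2 g26 INTENT T2): the bg-FREE CORE OF THE
# DISPLAYED Stage-13 PROVISOS `Stage13Params.Provisos₁₃Core` (`Node00/Record13` §9) RE-ISSUED GENERIC IN THE β-SLOT χ — `Stage13Params.Provisos₁₃CoreChi θ χ`
# (+ faces `.wtLaws`, `.tstep`) — with the field-wise receipt at `χ := chiβOfRecord₁₃ θ` and the RE-CENTRED instance `Stage13Params.Provisos₁₃CoreAx`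
# (`χ := chiβOfRecord₁₃Ax θ`, [Ax-3a]).  The six (H-U) ROW THEOREMS of `Node00/Record13` §4c along the χ-histories (`Stage13Params.…_of_localBg_chi`) are
# typed by node00-def-Y's `Node00/Record13LiveSelectorChi` §0 (dag-lead g40 WORDS 587 dedup of record) and are CITED from there by the socket leaves, not here

CITATION HEADER.  [III] = [Balaban1988Convergent] (CMP **119**) (2.7) p.255, (2.17)–(2.18) p.257, (2.21) p.258, (3.2)–(3.9) pp.265–266, (3.16) p.268,
(3.20)–(3.25) pp.269–270; [IV] = [Balaban1989LargeFieldI] (CMP **122**) (0.3)–(0.4) p.176, p.177; [I] = [Balaban1987RG1] (CMP **109**) (0.13) p.254,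
(0.19) p.255.  Every declaration below is the VERBATIM body of the like-named declaration of `Node00/Record13.lean` (§9 :1284 the structure, :557–:571
its faces) with EXACTLY the substitutions of [Ax-3b] `Node00/Record13Chi` (binder `(χ : ChiSlot F N)` after `θ`; `gOfRecord₁₃ F N θ p ↦
gOfRecord₁₃Chi F N θ χ p`, `EOfRecord₁₃ F N θ ↦ EOfRecord₁₃Chi F N θ χ`) — the recipe of [Ax-3c] `Node00/Record13CoPHChi` ∕ [Ax-3d] `Node00/Record13SepCoPHChi`
(nodeO-port PTA-2), applied to the `Stage13Params`-level core that the ⁵→⁶→⁷ door road of K0 (`Record13SepCoP` → `…SepCoPR` → `…SepCoPH`) and the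
separated live-selector sockets (`Record13SepLiveSelector`) read.  dag-n07-w3 g22's σ-closure table `SIGMA-CLOSURE-K0-V23-Ax.g22.md` (4ca252f7ab47910a),
row `Node00.Record13`: of the 18 statement-level centred entries not twinned by [Ax-3b], the structure, its constructor and its rows are typed here; the
six §4c theorems in node00-def-Y's `Record13LiveSelectorChi` §0.

Cell `pub-ymgap`, LADDER-YM R4 NODE 00, seat `pub-ymgap-node00-def-RR-2` g26 (second reader of the rate-record ∕ datum-key lineage; typing hand for
the second tranche by dag-lead's word).  `--kind definition --supports stmt-QuantumFields-27238 --as helper` (K0ᴬ `Record13SepCoPHInhabitedAx` door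
supply; count-neutral).  PURELY ADDITIVE: a NEW leaf; `Node00/Record13.lean` ∕ `Node00/Record13Chi.lean` are NOT edited (CRIT-1 g33 ruling terms (α):
body-freeze, new names only).

WHAT IS TYPED.
* §1 `structure Stage13Params.Provisos₁₃CoreChi (θ) (χ)` — the ten rows of `Provisos₁₃Core` VERBATIM, same names, same order (`zetaMeas` a plain
  required row, as in [Ax-3d] :84 — the source's `autoParam` default only fills it at construction sites and is not part of the statement), the
  history-reading rows (`intPiece`, `measω`, `measChi`, `rstep`) along the χ-histories `gOfRecord₁₃Chi θ χ p` at the χ-thresholds `EOfRecord₁₃Chi θ χ`;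
  the history-free rows (`zetaMeas`, `zetaUnity`, `zetaAbs`, `rzLaws`, `ztLaws`, `ztLocal`) unchanged.  Faces `.tstep` (def-T's step provisos from
  the core, `Provisos₁₃Core.tstep` verbatim) and `.wtLaws`.
* §2 RECEIPT `provisos₁₃CoreChi_chiβ_iff : θ.Provisos₁₃CoreChi (chiβOfRecord₁₃ θ) ↔ θ.Provisos₁₃Core` (field for field; `gOfRecord₁₃Chi θ (chiβOfRecord₁₃ θ)`
  and `EOfRecord₁₃Chi θ (chiβOfRecord₁₃ θ)` ARE the record's by `rfl`, [Ax-3b] receipts) and the RE-CENTRED instance `abbrev Stage13Params.Provisos₁₃CoreAx`.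
HONEST SCOPE.  Typed hypotheses (a `Prop`-valued structure) and bookkeeping transports; nothing of [III] ∕ [IV] ∕ [I] asserted or discharged; no row is
claimed to hold at any θ; K0ᴬ `stmt-QuantumFields-27238` is NOT closed here (door supply only); counts unmoved (typed 28∕28 · discharged 8∕28 · K 1∕4).
One finite `𝕋⁴` family at fixed `ε` — the route closes the conditional finite-𝕋⁴ rung `BalabanLadder.UV` only; NOT continuum ∕ ℝ⁴ ∕ OS; the Yang–Mills
mass gap (Clay) is NOT proved.  No `instance`, no `notation`, no `sorry`.
-/

noncomputable section

open MeasureTheory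
open scoped Matrix.Norms.L2Operator

namespace Literature.MathematicalPhysics.QuantumFieldTheory.Balaban1983to89.Node00

open T4Continuum AveragingRT T4FiniteEpsInhabited FlowStep FlowStepRuns DagBinding T4DatumAssembly
open B12Eq019ActionBody (integrand)

variable (F : T4Family) (N : ℕ) [NeZero N]

/-! ## §1. The bg-free core of the displayed provisos, generic in the β-slot χ -/

/-- **THE bg-FREE CORE OF THE DISPLAYED PROVISOS, Stage 13, GENERIC IN THE β-SLOT χ** (`Node00/Record13` §9 `Stage13Params.Provisos₁₃Core` VERBATIM —
same rows, same names, same order — along the χ-histories `gOfRecord₁₃Chi θ χ p` at the χ-thresholds `EOfRecord₁₃Chi θ χ`): the (H-ζ) bookkeeping row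
`zetaMeas`; the history-reading rows `intPiece` ∕ `measω` ∕ `measChi` (THEOREMS of (H-U) and the ζ-laws: node00-def-Y `Record13LiveSelectorChi` §0); `zetaUnity`, `zetaAbs`; def-R's (0.3)
provisos `rstep` in the INTEGRABLE FORM `RepData.ProvisosInt`; the laws `rzLaws`, `ztLaws`, `ztLocal` (history-free, verbatim).  At `χ := chiβOfRecord₁₃ θ`
it IS `Provisos₁₃Core` field for field (`provisos₁₃CoreChi_chiβ_iff`, §2).  HYPOTHESES, never admissibility clauses, never asserted.
[cite: Balaban1988Convergent, (2.7) p.255, (2.18) p.257, (2.21) p.258, (3.2)–(3.9) pp.265–266, (3.16) p.268, (3.20)–(3.21) p.269; Balaban1989LargeFieldI, (0.3)–(0.4) p.176; Balaban1987RG1, (0.13) p.254, (0.19) p.255] -/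
structure Stage13Params.Provisos₁₃CoreChi (θ : Stage13Params F N) (χ : ChiSlot F N) : Prop where
  /-- **(H-ζ) ROW**: the residual fluctuation factor `ζ` of the record is jointly measurable in the old and new fields (RECORD 12 measurability;
  a plain required row here — the source's `autoParam` default is a construction-site filler, not part of the statement) -/
  zetaMeas : ZetaMeasurable F N θ.ζ
  /-- the level-`k` pieces `χ_k(s)·slot_k(s)` of `ρ_k` are integrable, `k < K`, along the χ-histories -/
  intPiece : ∀ (p : B12.RunParams) (k : ℕ), k < p.K → ∀ s : SeqOfRecord F θ.ν θ.τ9.M (gOfRecord₁₃Chi F N θ χ p) p.K k,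
    Integrable (fun U => chiSeqOfRecord F N θ.ν θ.τ9.M (gOfRecord₁₃Chi F N θ χ p) p.K k s U *
      slotsOfRecord F N θ.ν θ.τ9 (EOfRecord₁₃Chi F N θ χ) (wOfRecord₉ F N θ.toStage9Params) θ.ppSel p
        (gOfRecord₁₃Chi F N θ χ p) k s U) (fieldMeasure (F.P p.K) k (SU N))
  /-- (O4): the label weights `ω = a·b·ζ` are jointly measurable in `(V′, U)`, `k < K`, along the χ-histories -/
  measω : ∀ (p : B12.RunParams) (k : ℕ), k < p.K → ∀ (s : SeqOfRecord F θ.ν θ.τ9.M (gOfRecord₁₃Chi F N θ χ p) p.K k)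
    (t : LbOfRecord F θ.ν p (gOfRecord₁₃Chi F N θ χ p) k),
    Measurable (fun z : GaugeField (F.P p.K) (k + 1) (SU N) × GaugeField (F.P p.K) k (SU N) =>
      ωOfRecord F N θ.ν θ.τ9.M p (gOfRecord₁₃Chi F N θ χ p) k θ.A₁ θ.ζ s t z.2 z.1)
  /-- the new front factors `χ_{k+1}(s′)` are measurable, `k < K`, along the χ-histories -/
  measChi : ∀ (p : B12.RunParams) (k : ℕ), k < p.K → ∀ s' : SeqOfRecord F θ.ν θ.τ9.M (gOfRecord₁₃Chi F N θ χ p) p.K (k + 1),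
    Measurable (chiSeqOfRecord F N θ.ν θ.τ9.M (gOfRecord₁₃Chi F N θ χ p) p.K (k + 1) s')
  /-- the residual `ζ` resolves unity -/
  zetaUnity : IsZetaUnity F N θ.ν θ.τ9.M θ.ζ
  /-- the residual `ζ` has `Σ |ζ| ≤ 1` -/
  zetaAbs : IsZetaAbsLeOne F N θ.ν θ.τ9.M θ.ζ
  /-- def-R's (0.3) provisos of the pre-𝐑 tower of record, INTEGRABLE FORM (`RepData.ProvisosInt`), at every level `k+1 ≤ K`, along the χ-histories, at
  every instance -/
  rstep : ∀ (p : B12.RunParams) (k : ℕ) [DecidableEq (PBond (F.P p.K) (k + 1))], k < p.K →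
    (towerRepOfRecord F N θ.ν θ.τ9 (slotsTOfRecord F N θ.ν θ.τ9 (EOfRecord₁₃Chi F N θ χ) (wOfRecord₉ F N θ.toStage9Params) θ.ppSel)
      θ.ppSel p (gOfRecord₁₃Chi F N θ χ p) (k + 1)).toRepData.ProvisosInt
  /-- 11c's laws of the residual §2 data -/
  rzLaws : ∀ K, (θ.Rz K).Laws
  /-- 12a's law of the residual part of the 𝐓-weights: `ζ0 ≥ 0` -/
  ztLaws : ∀ K, (θ.Zt K).Laws
  /-- the locality law of the residual 𝐓-weight factor -/
  ztLocal : ∀ K, (θ.Zt K).LocalLaws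

variable {F N}

/-- The weight laws of the run FROM the χ-generic core (`WtOfRecord₁₃_laws`; the weights do not read the β-slot). [cite: Balaban1988Convergent, (2.21) p.258 (bookkeeping)] -/
theorem Stage13Params.Provisos₁₃CoreChi.wtLaws {θ : Stage13Params F N} {χ : ChiSlot F N} (h : θ.Provisos₁₃CoreChi F N χ) (p : B12.RunParams) :
    (WtOfRecord₁₃ F N θ p).Laws :=
  WtOfRecord₁₃_laws h.ztLaws p

/-- **def-T's step provisos FROM the χ-generic core** at every step `k < K`, along the χ-histories (`Provisos₁₃Core.tstep` verbatim).
[cite: Balaban1988Convergent, (3.2)–(3.9) pp.265–266, (3.16) p.268, (3.24)–(3.25) p.270] -/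
theorem Stage13Params.Provisos₁₃CoreChi.tstep {θ : Stage13Params F N} {χ : ChiSlot F N} (h : θ.Provisos₁₃CoreChi F N χ) (p : B12.RunParams) (k : ℕ)
    (hk : k < p.K) :
    TStepProvisos F N θ.ν θ.τ9 (EOfRecord₁₃Chi F N θ χ) (wOfRecord₉ F N θ.toStage9Params) θ.ppSel p
      (gOfRecord₁₃Chi F N θ χ p) k where
  intPiece := h.intPiece p k hk
  measW := fun s' => measurable_wOfRecord F N θ.ν θ.τ9.M θ.A₁ θ.ζ p (gOfRecord₁₃Chi F N θ χ p) k (h.measω p k hk) s'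
  absW_le := fun s' U V' => abs_wOfRecord_le_one F N θ.ν θ.τ9.M θ.A₁ h.zetaAbs p (gOfRecord₁₃Chi F N θ χ p) k s' U V'
  measChi := h.measChi p k hk
  unity := isStepUnity_wOfRecord F N θ.ν θ.τ9.M θ.A₁ h.zetaUnity p (gOfRecord₁₃Chi F N θ χ p) k

/-! ## §2. Receipt at the record's β-slot and the re-centred instance -/

section Receipts
variable (θ : Stage13Params F N)

/-- Receipt: the χ-generic core provisos at the record's β-slot are the record's core provisos, field for field (`gOfRecord₁₃Chi θ (chiβOfRecord₁₃ θ)`,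
`EOfRecord₁₃Chi θ (chiβOfRecord₁₃ θ)` are the record's by `rfl`). [cite: Balaban1988Convergent, (2.18) p.257 (bookkeeping)] -/
theorem provisos₁₃CoreChi_chiβ_iff : θ.Provisos₁₃CoreChi F N (chiβOfRecord₁₃ F N θ) ↔ θ.Provisos₁₃Core F N :=
  ⟨fun h => ⟨h.zetaMeas, h.intPiece, h.measω, h.measChi, h.zetaUnity, h.zetaAbs, h.rstep, h.rzLaws, h.ztLaws, h.ztLocal⟩,
   fun h => ⟨h.zetaMeas, h.intPiece, h.measω, h.measChi, h.zetaUnity, h.zetaAbs, h.rstep, h.rzLaws, h.ztLaws, h.ztLocal⟩⟩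

end Receipts

variable (F N)

/-- **The bg-free core provisos, RE-CENTRED** (instance `χ := chiβOfRecord₁₃Ax θ`, [Ax-3a] `chiFixed29Ax`). [cite: Balaban1988Convergent, (2.18) p.257, (3.16) p.268] -/
abbrev Stage13Params.Provisos₁₃CoreAx (θ : Stage13Params F N) : Prop := θ.Provisos₁₃CoreChi F N (chiβOfRecord₁₃Ax F N θ)

end Literature.MathematicalPhysics.QuantumFieldTheory.Balaban1983to89.Node00

end
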